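import Mathlib
import Summits.Ventures.PercRepro2.CrossAPrimeVMarkedTwoRouteConn
import Summits.Ventures.PercRepro2.CrossAPrimeVMarkedCutMark

/-!
# The v-marked vdB–Kahn inequality when `v` is a two-route mark between `o` and `b`
(blind cell PercRepro2, p5 g41; S4 §2.4 (s) addendum 61 — part 2: the masses and the theorem)

With the connectivity lemmas of `CrossAPrimeVMarkedTwoRouteConn.lean` (`v`'s only edges are
`fo = {v, o}`, `fb = {v, b}`; `O`, `B` = the events `a₁ ↔ o`, `a₁ ↔ b` with both edges closed):
`o ∈ A ⟺ O ∨ (fo ∧ fb ∧ B)`, `b ∈ A ⟺ B ∨ (fo ∧ fb ∧ O)`, `v ∈ A ⟺ (fo ∧ O) ∨ (fb ∧ B)`, so with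
`α = p fo`, `β = p fb`, `x = P(O)`, `y = P(B)`, `r₀ = P(O ∩ B)` the seven masses of `VMarkedVdBK` are
explicit (`mass_*`) and

  `RHS − LHS = αβ(1 − x − y + r₀)·[(x − r₀) + (y − r₀) + r₀(1 + α + β − 2αβ)] + (r₀ − xy)(1 − αβ)(α + β − 2αβ) ≥ 0`

(`twoRoute_algebra`, the second term by Harris on `G − v`): **`vMarkedVdBK_of_twoRoute`** — (★₂′) for
every two-route mark, with any graph around it (the 4-cycle `a₁–o–v–b–a₁` with `v` opposite the root
is the smallest instance).  Own work; standard axioms.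
-/

namespace Summit.Ventures.PercRepro2

open CrossAPrimeVMarked CrossAPrimeVMarkedCut CrossAPrimeVMarkedLeaf CrossAPrimeIsolatedFlip OneEdge
  CrossAPrimeVMarkedPendantRoot CrossAPrimeVMarkedCutMark

namespace CrossAPrimeVMarkedTwoRoute

variable {V : Type*} {E : Type*} [Fintype E] [DecidableEq E] [Fintype V] [DecidableEq V]
  {R : Type*} [Field R] [LinearOrder R] [IsStrictOrderedRing R]
variable {ends : E → Sym2 V}

section Slack

variable {fo fb : E} {a₁ v o b : V}

omit [Fintype V] [DecidableEq V] [LinearOrder R] [IsStrictOrderedRing R] in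
/-- A coin event (determined by `{fo, fb}`) is independent of an event determined by the other
edges. -/
lemma prob_coin_inter (p : E → R) {C X : Set (Config E)}
    (hC : DependsOn (· ∈ C) ({fo, fb} : Set E)) (hX : DependsOn (· ∈ X) (({fo, fb} : Set E)ᶜ)) :
    prob p (C ∩ X) = prob p C * prob p X :=
  prob_inter_eq_mul_of_dependsOn p disjoint_compl_right hC hX

omit [Fintype V] [DecidableEq V] [LinearOrder R] [IsStrictOrderedRing R] in
/-- The two coins are independent: `P(fo open, fb open) = p fo · p fb`. -/
lemma prob_openEdge_inter_openEdge (p : E → R) (hne : fo ≠ fb) :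
    prob p (openEdge fo ∩ openEdge fb) = p fo * p fb := by
  rw [prob_inter_eq_mul_of_dependsOn p (Set.disjoint_singleton.2 hne) (dependsOn_openEdge fo)
    (dependsOn_openEdge fb), prob_openEdge, prob_openEdge]

omit [Fintype V] [DecidableEq V] [LinearOrder R] [IsStrictOrderedRing R] in
/-- `P(fo open, fb closed) = p fo · (1 − p fb)`. -/
lemma prob_openEdge_inter_closedEdge (p : E → R) (hne : fo ≠ fb) :
    prob p (openEdge fo ∩ (openEdge fb)ᶜ) = p fo * (1 - p fb) := by
  rw [← closedEdge_eq_compl, prob_inter_eq_mul_of_dependsOn p (Set.disjoint_singleton.2 hne)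
    (dependsOn_openEdge fo) (dependsOn_closedEdge fb), prob_openEdge, prob_closedEdge]

omit [Fintype E] [DecidableEq E] [Fintype V] [DecidableEq V] in
/-- `{fo open, fb open}` is determined by `{fo, fb}`. -/
lemma dependsOn_openEdge_pair (fo fb : E) :
    DependsOn (· ∈ openEdge fo ∩ openEdge fb) ({fo, fb} : Set E) := by
  have := dependsOn_inter (dependsOn_openEdge fo) (dependsOn_openEdge fb)
  rwa [Set.singleton_union] at this

omit [Fintype E] [DecidableEq E] [Fintype V] [DecidableEq V] in
/-- `{fo open, fb closed}` is determined by `{fo, fb}`. -/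
lemma dependsOn_openEdge_compl_pair (fo fb : E) :
    DependsOn (· ∈ openEdge fo ∩ (openEdge fb)ᶜ) ({fo, fb} : Set E) := by
  have := dependsOn_inter (dependsOn_openEdge fo) (dependsOn_compl (dependsOn_openEdge fb))
  rwa [Set.singleton_union] at this

omit [Fintype E] [DecidableEq E] [Fintype V] [DecidableEq V] in
/-- `{fo open}` is determined by `{fo, fb}`. -/
lemma dependsOn_openEdge_left (fo fb : E) :
    DependsOn (· ∈ openEdge fo) ({fo, fb} : Set E) :=
  DependsOn.mono (by simp) (dependsOn_openEdge fo)

omit [Fintype E] [DecidableEq E] [Fintype V] [DecidableEq V] in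
/-- `{fb open}` is determined by `{fo, fb}`. -/
lemma dependsOn_openEdge_right (fo fb : E) :
    DependsOn (· ∈ openEdge fb) ({fo, fb} : Set E) :=
  DependsOn.mono (by simp) (dependsOn_openEdge fb)

section Masses

variable {fo fb : E} {O B : Set (Config E)}

omit [Fintype V] [DecidableEq V] [LinearOrder R] [IsStrictOrderedRing R] in
/-- `P(R_o) = 1 − P(O) − αβ·P(Oᶜ ∩ B)`. -/
lemma mass_o_compl (p : E → R) (hne : fo ≠ fb) (dO : DependsOn (· ∈ O) (({fo, fb} : Set E)ᶜ))
    (dB : DependsOn (· ∈ B) (({fo, fb} : Set E)ᶜ)) :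
    prob p (O ∪ (openEdge fo ∩ openEdge fb ∩ B))ᶜ =
      1 - prob p O - p fo * p fb * prob p (Oᶜ ∩ B) := by
  have dOB : DependsOn (· ∈ O ∩ B) (({fo, fb} : Set E)ᶜ) := by
    have := dependsOn_inter dO dB
    rwa [Set.union_self] at this
  have c11 := prob_openEdge_inter_openEdge (fo := fo) (fb := fb) p hne
  have iBO : prob p (O ∩ B) + prob p (Oᶜ ∩ B) = prob p B := by
    have := prob_inter_add_prob_inter_compl p B O
    rwa [Set.inter_comm B O, Set.inter_comm B Oᶜ] at this
  rw [prob_compl, prob_union_eq]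
  have e : O ∩ (openEdge fo ∩ openEdge fb ∩ B) = (openEdge fo ∩ openEdge fb) ∩ (O ∩ B) := by
    ext ω; simp only [Set.mem_inter_iff]; tauto
  rw [e, prob_coin_inter p (dependsOn_openEdge_pair fo fb) dOB,
    prob_coin_inter p (dependsOn_openEdge_pair fo fb) dB, c11]
  linear_combination (p fo * p fb) * iBO

omit [Fintype V] [DecidableEq V] [LinearOrder R] [IsStrictOrderedRing R] in
/-- `P(R_b ∩ L) = α(1 − β)·P(O ∩ Bᶜ)`. -/
lemma mass_b_compl_v (p : E → R) (hne : fo ≠ fb) (dO : DependsOn (· ∈ O) (({fo, fb} : Set E)ᶜ))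
    (dB : DependsOn (· ∈ B) (({fo, fb} : Set E)ᶜ)) :
    prob p ((B ∪ (openEdge fo ∩ openEdge fb ∩ O))ᶜ ∩ ((openEdge fo ∩ O) ∪ (openEdge fb ∩ B))) =
      p fo * (1 - p fb) * prob p (O ∩ Bᶜ) := by
  have dOBc : DependsOn (· ∈ O ∩ Bᶜ) (({fo, fb} : Set E)ᶜ) := by
    have := dependsOn_inter dO (dependsOn_compl dB)
    rwa [Set.union_self] at this
  have e : (B ∪ (openEdge fo ∩ openEdge fb ∩ O))ᶜ ∩ ((openEdge fo ∩ O) ∪ (openEdge fb ∩ B)) =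
      (openEdge fo ∩ (openEdge fb)ᶜ) ∩ (O ∩ Bᶜ) := by
    ext ω
    simp only [Set.mem_inter_iff, Set.mem_union, Set.mem_compl_iff]
    tauto
  rw [e, prob_coin_inter p (dependsOn_openEdge_compl_pair fo fb) dOBc,
    prob_openEdge_inter_closedEdge p hne]

omit [Fintype V] [DecidableEq V] [LinearOrder R] [IsStrictOrderedRing R] in
/-- `P(L) = α·P(O) + β·P(B) − αβ·P(O ∩ B)`. -/
lemma mass_v (p : E → R) (hne : fo ≠ fb) (dO : DependsOn (· ∈ O) (({fo, fb} : Set E)ᶜ))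
    (dB : DependsOn (· ∈ B) (({fo, fb} : Set E)ᶜ)) :
    prob p ((openEdge fo ∩ O) ∪ (openEdge fb ∩ B)) =
      p fo * prob p O + p fb * prob p B - p fo * p fb * prob p (O ∩ B) := by
  have dOB : DependsOn (· ∈ O ∩ B) (({fo, fb} : Set E)ᶜ) := by
    have := dependsOn_inter dO dB
    rwa [Set.union_self] at this
  rw [prob_union_eq, prob_coin_inter p (dependsOn_openEdge_left fo fb) dO,
    prob_coin_inter p (dependsOn_openEdge_right fo fb) dB]
  have e : (openEdge fo ∩ O) ∩ (openEdge fb ∩ B) = (openEdge fo ∩ openEdge fb) ∩ (O ∩ B) := by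
    ext ω; simp only [Set.mem_inter_iff]; tauto
  rw [e, prob_coin_inter p (dependsOn_openEdge_pair fo fb) dOB,
    prob_openEdge_inter_openEdge p hne, prob_openEdge, prob_openEdge]

omit [Fintype V] [DecidableEq V] [LinearOrder R] [IsStrictOrderedRing R] in
/-- `P(R_{o,b}) = P(Oᶜ ∩ Bᶜ)`. -/
lemma mass_ob_compl (p : E → R) :
    prob p ((O ∪ (openEdge fo ∩ openEdge fb ∩ B))ᶜ ∩ (B ∪ (openEdge fo ∩ openEdge fb ∩ O))ᶜ) =
      prob p (Oᶜ ∩ Bᶜ) := by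
  congr 1
  ext ω
  simp only [Set.mem_inter_iff, Set.mem_union, Set.mem_compl_iff]
  tauto

omit [Fintype V] [DecidableEq V] [LinearOrder R] [IsStrictOrderedRing R] in
/-- `P(R_{o,b} ∩ L) = 0`. -/
lemma mass_ob_compl_v (p : E → R) :
    prob p ((O ∪ (openEdge fo ∩ openEdge fb ∩ B))ᶜ ∩ (B ∪ (openEdge fo ∩ openEdge fb ∩ O))ᶜ ∩
      ((openEdge fo ∩ O) ∪ (openEdge fb ∩ B))) = 0 := by
  rw [← prob_empty p]
  congr 1
  ext ω
  simp only [Set.mem_inter_iff, Set.mem_union, Set.mem_compl_iff, Set.mem_empty_iff_false]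
  tauto

omit [Fintype E] [DecidableEq E] [Fintype V] [DecidableEq V] in
/-- The algebraic core: with `0 ≤ α, β ≤ 1`, the cells `x − r, y − r, r, 1 − x − y + r ≥ 0` and Harris
`xy ≤ r`,
`(1 − x − αβ(y − r))·α(1 − β)(x − r) + (1 − y − αβ(x − r))·β(1 − α)(y − r) ≤ (αx + βy − αβr)(1 − x − y + r)`. -/
lemma twoRoute_algebra {α β x y r : R} (hα0 : 0 ≤ α) (hα1 : α ≤ 1) (hβ0 : 0 ≤ β) (hβ1 : β ≤ 1)
    (hq : 0 ≤ x - r) (hp : 0 ≤ y - r) (hr : 0 ≤ r) (ha : 0 ≤ 1 - x - y + r) (hH : x * y ≤ r) :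
    (1 - x - α * β * (y - r)) * (α * (1 - β) * (x - r)) +
        (1 - y - α * β * (x - r)) * (β * (1 - α) * (y - r)) ≤
      (α * x + β * y - α * β * r) * (1 - x - y + r) + 0 := by
  have t1 := mul_nonneg hα0 (sub_nonneg.2 hβ1)
  have t2 := mul_nonneg hβ0 (sub_nonneg.2 hα1)
  have t3 := mul_nonneg (sub_nonneg.2 hα1) (sub_nonneg.2 hβ1)
  have h0 : 0 ≤ 1 + α + β - 2 * (α * β) := by linarith only [t1, t2, t3]
  have h1αβ : 0 ≤ 1 - α * β := by linarith only [t1, t2, t3]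
  have hαβ2 : 0 ≤ α + β - 2 * (α * β) := by linarith only [t1, t2]
  have hS : 0 ≤ (y - r) + (x - r) + r * (1 + α + β - 2 * (α * β)) := by
    have := mul_nonneg hr h0
    linarith only [this, hp, hq]
  have h1 := mul_nonneg (mul_nonneg (mul_nonneg hα0 hβ0) ha) hS
  have h2 := mul_nonneg (mul_nonneg (sub_nonneg.2 hH) h1αβ) hαβ2
  linarith only [h1, h2]

end Masses

omit [Fintype V] in
/-- **(★₂′) for a two-route mark**: `fo = {v, o}`, `fb = {v, b}` the only edges at `v`,
`v ∉ {a₁, o, b}`.  With `α = p fo`, `β = p fb` and the cells `x = P(O)`, `y = P(B)`,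
`r₀ = P(O ∩ B)` of `G − v`:
`RHS − LHS = αβ(1 − x − y + r₀)(x + y − 2r₀ + r₀(1 + α + β − 2αβ)) + (r₀ − xy)(1 − αβ)(α + β − 2αβ)`. -/
theorem vMarkedVdBK_of_twoRoute {fo fb : E} {a₁ v o b : V} {p : E → R} (hp : IsProbVec p)
    (hfo : ends fo = s(v, o)) (hfb : ends fb = s(v, b)) (hv : ∀ e, v ∈ ends e → e = fo ∨ e = fb)
    (hne : fo ≠ fb) (hav : a₁ ≠ v) (hov : o ≠ v) (hbv : b ≠ v) : VMarkedVdBK p ends a₁ v o b := by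
  unfold VMarkedVdBK
  -- the events of `G − v`
  set O : Set (Config E) := {ω | Function.update (Function.update ω fo false) fb false ∈ connEvent ends a₁ o} with hO
  set B : Set (Config E) := {ω | Function.update (Function.update ω fo false) fb false ∈ connEvent ends a₁ b} with hB
  have eo : connEvent ends a₁ o = O ∪ (openEdge fo ∩ openEdge fb ∩ B) := by
    ext ω
    simp only [mem_connEvent, Set.mem_union, Set.mem_inter_iff, hO, hB, mem_openEdge,
      Set.mem_setOf_eq]
    rw [conn_twoRoute_o hfo hfb hv hne hav hov hbv ω]
    tauto
  have eb : connEvent ends a₁ b = B ∪ (openEdge fo ∩ openEdge fb ∩ O) := by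
    ext ω
    simp only [mem_connEvent, Set.mem_union, Set.mem_inter_iff, hO, hB, mem_openEdge,
      Set.mem_setOf_eq]
    rw [conn_twoRoute_b hfo hfb hv hne hav hov hbv ω]
    tauto
  have ev : connEvent ends a₁ v = (openEdge fo ∩ O) ∪ (openEdge fb ∩ B) := by
    ext ω
    simp only [mem_connEvent, Set.mem_union, Set.mem_inter_iff, hO, hB, mem_openEdge,
      Set.mem_setOf_eq]
    rw [conn_twoRoute_v hfo hfb hv hne hav hov hbv ω]
  have dO : DependsOn (· ∈ O) (({fo, fb} : Set E)ᶜ) := dependsOn_closeTwo fo fb (connEvent ends a₁ o)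
  have dB : DependsOn (· ∈ B) (({fo, fb} : Set E)ᶜ) := dependsOn_closeTwo fo fb (connEvent ends a₁ b)
  have uO : IsUpperSet O := fun ω ω' h hω => conn_mono (closeTwo_mono fo fb h) hω
  have uB : IsUpperSet B := fun ω ω' h hω => conn_mono (closeTwo_mono fo fb h) hω
  clear_value O B
  rw [avoidAll_pair, avoidAll_singleton, avoidAll_singleton, eo, eb, ev]
  -- Harris on `G − v`
  have hH : prob p O * prob p B ≤ prob p (O ∩ B) := prob_mul_prob_le_prob_inter hp uO uB
  -- the seven masses
  have m1 := mass_o_compl p hne dO dB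
  have m3 : prob p (B ∪ (openEdge fo ∩ openEdge fb ∩ O))ᶜ =
      1 - prob p B - p fo * p fb * prob p (Bᶜ ∩ O) := mass_o_compl p hne dB dO
  have m2 := mass_b_compl_v p hne dO dB
  have m4 : prob p ((O ∪ (openEdge fo ∩ openEdge fb ∩ B))ᶜ ∩ ((openEdge fo ∩ O) ∪ (openEdge fb ∩ B))) =
      p fb * (1 - p fo) * prob p (Oᶜ ∩ B) := by
    have dO' : DependsOn (· ∈ O) (({fb, fo} : Set E)ᶜ) := by rw [Set.pair_comm]; exact dO
    have dB' : DependsOn (· ∈ B) (({fb, fo} : Set E)ᶜ) := by rw [Set.pair_comm]; exact dB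
    have := mass_b_compl_v (fo := fb) (fb := fo) (O := B) (B := O) p hne.symm dB' dO'
    rwa [Set.union_comm (openEdge fb ∩ B), Set.inter_comm (openEdge fb) (openEdge fo),
      Set.inter_comm B Oᶜ] at this
  have m5 := mass_v p hne dO dB
  have m6 := mass_ob_compl (O := O) (B := B) (fo := fo) (fb := fb) p
  have m7 := mass_ob_compl_v (O := O) (B := B) (fo := fo) (fb := fb) p
  rw [m1, m2, m3, m4, m5, m6, m7]
  -- the cells of `G − v` in terms of `x = P(O)`, `y = P(B)`, `r₀ = P(O ∩ B)`
  have iOB : prob p (O ∩ B) + prob p (O ∩ Bᶜ) = prob p O := prob_inter_add_prob_inter_compl p O B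
  have iBO : prob p (B ∩ O) + prob p (B ∩ Oᶜ) = prob p B := prob_inter_add_prob_inter_compl p B O
  have iOc : prob p (Oᶜ ∩ B) + prob p (Oᶜ ∩ Bᶜ) = prob p Oᶜ := prob_inter_add_prob_inter_compl p Oᶜ B
  have hOc : prob p Oᶜ = 1 - prob p O := prob_compl p O
  have sBO : prob p (B ∩ O) = prob p (O ∩ B) := by rw [Set.inter_comm]
  have sBOc : prob p (B ∩ Oᶜ) = prob p (Oᶜ ∩ B) := by rw [Set.inter_comm]
  have sBcO : prob p (Bᶜ ∩ O) = prob p (O ∩ Bᶜ) := by rw [Set.inter_comm]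
  have hq0 := prob_nonneg hp (O ∩ Bᶜ)
  have hp0 := prob_nonneg hp (Oᶜ ∩ B)
  have ha0 := prob_nonneg hp (Oᶜ ∩ Bᶜ)
  have hr0 := prob_nonneg hp (O ∩ B)
  have cq : prob p (O ∩ Bᶜ) = prob p O - prob p (O ∩ B) := by linarith only [iOB]
  have cp : prob p (Oᶜ ∩ B) = prob p B - prob p (O ∩ B) := by linarith only [iBO, sBO, sBOc]
  have ca : prob p (Oᶜ ∩ Bᶜ) = 1 - prob p O - prob p B + prob p (O ∩ B) := by
    linarith only [iOc, hOc, cp]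
  rw [sBcO, cq, cp, ca]
  rw [cq] at hq0
  rw [cp] at hp0
  rw [ca] at ha0
  exact twoRoute_algebra (hp.nonneg fo) (hp.le_one fo) (hp.nonneg fb) (hp.le_one fb) hq0 hp0 hr0
    ha0 hH

end Slack

end CrossAPrimeVMarkedTwoRoute

end Summit.Ventures.PercRepro2
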